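import Literature.MathematicalPhysics.QuantumFieldTheory.QCDSiteRPFrame
import Literature.MathematicalPhysics.QuantumLattice.GrassmannGaussianMeasureChange
import HarnessLib

/-!
# Towards `WilsonQCDSiteReflectionPositivityAP`: the rotated antiperiodic Wilson quark action

Theorem-and-helper companion of `QCDSiteRPFrame` / `QCDSpinDiagonalBasis` / `QCDTimeReflectionProofs`
(see also `QCDSiteRPBlocks`, whose `rotAction mq U` is the same element as `quadratic ℂ (rotDirac U mq)`).
In the `γ₀`-diagonal frame (`R' = spinUnrot`, `Θ' = fermiThetaRot`) the antiperiodic Wilson–Dirac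
form of `N_f` flavours of `r = 1` quarks on the four-torus of odd side `L` becomes `ψ̄ M(U) ψ` with
`M(U) = rotDirac U mq = (1⊗W)(−D^{AP}(U))(1⊗Wᴴ)`; this file records

* `rotGamma μ = W γ_μ Wᴴ` (`rotGamma 0 = 2 diag(1,1,−1,−1)`; the spatial `rotGamma j` have no entries
  between spins of equal `γ₀`-sign, `rotGamma_apply_eq_zero_of_ne`), the entries of `M(U)`
  (`rotDirac_apply`: mass `−2(m_f+4)`, hops `hopF · (2 − Γ_μ)/2 + hopB · (2 + Γ_μ)/2` per flavour);
* `spinUnrot_fermiBoltzmannAP_eq : R' e^{−ψ̄D^{AP}(U)ψ} = e^{ψ̄M(U)ψ}` and the REFLECTION SYMMETRY in the frame, `fermiThetaRot_quadratic_rotDirac : Θ'(ψ̄M(U)ψ) = ψ̄M(Θ'U)ψ` (`L` odd; from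
  `thetaMatrix_diracMatrixAP`), together with the entrywise form of `Θ'` on quadratic forms
  (`fermiThetaRot_quadratic_eq`, `quadratic_injective`, `thetaMatrixRot_apply`);
* time-block masks `maskT ρ A` of a fermion matrix and their behaviour under `Θ'`
  (`thetaMatrixRot_maskT`), the four time classes of index pairs of the site reflection on the odd
  torus (`posR`, `negR`, `zeroR`, `crossR`: Montvay–Münster's `S = S₊ + S₋ + S₀` plus the crossing
  couplings of the antiperiodic layer `S → S+1`), the split `ψ̄Mψ = Q₊ + Q₋ + Q₀ + Q_c`
  (`quadratic_rotDirac_split`) and `Θ' Q₊(U) = Q₋(Θ'U)` (`fermiThetaRot_posPart`).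

References: I. Montvay, G. Münster, *Quantum Fields on a Lattice* (CUP 1994) §4.2.3 (4.93)–(4.106),
§4.2.4 (4.112)–(4.115); M. Lüscher, Commun. Math. Phys. 54 (1977) 283. All statements are proved; the
`def`s are explicit matrices, no named fact is introduced.
-/

open MeasureTheory
open scoped Matrix ComplexConjugate
open Literature.Probability Literature.Probability.LatticeModels Literature.MathematicalPhysics.QuantumLattice

noncomputable section

namespace Literature.MathematicalPhysics.QuantumFieldTheory

/-! ### The rotated `γ`-matrices -/

section RotGamma

/-- `Γ_μ = W γ_μ Wᴴ`. [folklore] -/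
def rotGamma (μ : Fin 4) : Matrix (Fin 4) (Fin 4) ℂ := spinW * euclideanGamma μ * spinWᴴ

/-- `Γ₀ = 2 diag(ε)`. [cite: MontvayMunster1994, App. 8.1.2 (8.10)] -/
theorem rotGamma_zero : rotGamma 0 = (2 : ℂ) • Matrix.diagonal spinSign := by
  rw [rotGamma, spinW_mul_euclideanGamma_zero, Matrix.mul_assoc, spinW_mul_conjTranspose, Matrix.mul_smul,
    Matrix.mul_one]

/-- Entries of `Γ₀`. [folklore] -/
theorem rotGamma_zero_apply (r s : Fin 4) : rotGamma 0 r s = if r = s then 2 * spinSign r else 0 := by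
  rw [rotGamma_zero, Matrix.smul_apply, Matrix.diagonal_apply]
  split_ifs <;> simp

/-- `Γ₀ Γ_j + Γ_j Γ₀ = 0` for a spatial direction `j`. [folklore] -/
theorem rotGamma_zero_anticomm {j : Fin 4} (hj : j ≠ 0) : rotGamma 0 * rotGamma j + rotGamma j * rotGamma 0 = 0 := by
  have h := euclideanGamma_anticomm_holds 0 j
  rw [if_neg (Ne.symm hj)] at h
  have h2 : spinWᴴ * spinW = (2 : ℂ) • (1 : Matrix (Fin 4) (Fin 4) ℂ) := conjTranspose_mul_spinW
  calc rotGamma 0 * rotGamma j + rotGamma j * rotGamma 0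
      = spinW * euclideanGamma 0 * (spinWᴴ * spinW) * euclideanGamma j * spinWᴴ +
          spinW * euclideanGamma j * (spinWᴴ * spinW) * euclideanGamma 0 * spinWᴴ := by
        simp only [rotGamma, Matrix.mul_assoc]
    _ = (2 : ℂ) • (spinW * (euclideanGamma 0 * euclideanGamma j + euclideanGamma j * euclideanGamma 0) * spinWᴴ) := by
        rw [h2]
        simp only [Matrix.mul_smul, Matrix.mul_one, Matrix.smul_mul, Matrix.mul_add, Matrix.add_mul, smul_add,
          Matrix.mul_assoc]
    _ = 0 := by rw [h, Matrix.mul_zero, Matrix.zero_mul, smul_zero]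

/-- `spinSign` takes the values `±1`. [folklore] -/
theorem spinSign_mul_self (r : Fin 4) : spinSign r * spinSign r = 1 := by
  fin_cases r <;> simp [spinSign]

/-- `spinSign` is real. [folklore] -/
@[simp] theorem star_spinSign (r : Fin 4) : star (spinSign r) = spinSign r := by
  fin_cases r <;> simp [spinSign]

/-- `spinSign r ≠ 0`. [folklore] -/
theorem spinSign_ne_zero (r : Fin 4) : spinSign r ≠ 0 := by
  fin_cases r <;> simp [spinSign]


/-- `ε_r = 1` for the lower rotated spins `r < 2`. [folklore] -/
theorem spinSign_of_lt {r : Fin 4} (h : r.val < 2) : spinSign r = 1 := by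
  fin_cases r <;> simp [spinSign] at h ⊢

/-- `ε_r = −1` for the upper rotated spins `r ≥ 2`. [folklore] -/
theorem spinSign_of_le {r : Fin 4} (h : 2 ≤ r.val) : spinSign r = -1 := by
  fin_cases r <;> simp [spinSign] at h ⊢

/-- **The spatial `Γ_j` have no entries between spins of equal `γ₀`-eigenvalue** (`γ₀` anticommutes
with `γ_j`): the spatial hopping couples upper with lower slice variables only. [cite: MontvayMunster1994, §4.2.3 (4.103)–(4.104)] -/
theorem rotGamma_apply_eq_zero_of_eq {j : Fin 4} (hj : j ≠ 0) {r s : Fin 4} (h : spinSign r = spinSign s) :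
    rotGamma j r s = 0 := by
  have hrs := congrFun (congrFun (rotGamma_zero_anticomm hj) r) s
  rw [Matrix.add_apply, Matrix.zero_apply, Matrix.mul_apply, Matrix.mul_apply] at hrs
  simp only [rotGamma_zero_apply, ite_mul, zero_mul, mul_ite, mul_zero, Finset.sum_ite_eq, Finset.sum_ite_eq',
    Finset.mem_univ, if_true] at hrs
  rw [h] at hrs
  have h4 : (2 * spinSign s + 2 * spinSign s) * rotGamma j r s = 0 := by
    rw [← hrs]; ring
  rcases mul_eq_zero.1 h4 with h0 | h0
  · exfalso
    apply spinSign_ne_zero s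
    have : (4 : ℂ) * spinSign s = 0 := by rw [← h0]; ring
    simpa using this
  · exact h0

/-- `W (c − γ_μ) Wᴴ = 2c − Γ_μ`. [folklore] -/
theorem spinW_mul_smul_one_sub (c : ℂ) (μ : Fin 4) :
    spinW * (c • (1 : Matrix (Fin 4) (Fin 4) ℂ) - euclideanGamma μ) * spinWᴴ = (2 * c) • 1 - rotGamma μ := by
  rw [Matrix.mul_sub, Matrix.sub_mul, rotGamma, Matrix.mul_smul, Matrix.mul_one, Matrix.smul_mul,
    spinW_mul_conjTranspose, smul_smul, mul_comm]

/-- `W (c + γ_μ) Wᴴ = 2c + Γ_μ`. [folklore] -/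
theorem spinW_mul_smul_one_add (c : ℂ) (μ : Fin 4) :
    spinW * (c • (1 : Matrix (Fin 4) (Fin 4) ℂ) + euclideanGamma μ) * spinWᴴ = (2 * c) • 1 + rotGamma μ := by
  rw [Matrix.mul_add, Matrix.add_mul, rotGamma, Matrix.mul_smul, Matrix.mul_one, Matrix.smul_mul,
    spinW_mul_conjTranspose, smul_smul, mul_comm]

end RotGamma

/-! ### The rotated Dirac matrix -/

section RotDirac

open GrassmannAlgebra

local notation "𝔾" => Matrix.specialUnitaryGroup (Fin 3) ℂ

variable {Nf L : ℕ} [NeZero L]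

/-- Row sums against a spin block collapse to a spin sum. [folklore] -/
theorem spinBlock_mul_apply (M : Matrix (Fin 4) (Fin 4) ℂ) (A : Matrix (FermiIdx Nf L) (FermiIdx Nf L) ℂ)
    (v : QuarkVar Nf L) (j : FermiIdx Nf L) :
    (spinBlock M * A : Matrix (FermiIdx Nf L) (FermiIdx Nf L) ℂ) (quarkEquiv v) j =
      ∑ β : Fin 4, M v.2.2.2 β * A (quarkEquiv (v.1, (v.2.1, v.2.2.1, β))) j := by
  obtain ⟨f, x, a, α⟩ := v
  rw [Matrix.mul_apply, ← Equiv.sum_comp quarkEquiv]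
  simp only [spinBlock_apply, Fintype.sum_prod_type, ite_mul, zero_mul]
  rw [Finset.sum_eq_single f (fun f' _ hf' => by simp [Ne.symm hf']) (fun h => absurd (Finset.mem_univ f) h),
    Finset.sum_eq_single x (fun x' _ hx' => by simp [Ne.symm hx']) (fun h => absurd (Finset.mem_univ x) h),
    Finset.sum_eq_single a (fun a' _ ha' => by simp [Ne.symm ha']) (fun h => absurd (Finset.mem_univ a) h)]
  simp

/-- Column sums against a spin block collapse to a spin sum. [folklore] -/
theorem mul_spinBlock_apply (A : Matrix (FermiIdx Nf L) (FermiIdx Nf L) ℂ) (M : Matrix (Fin 4) (Fin 4) ℂ)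
    (i : FermiIdx Nf L) (w : QuarkVar Nf L) :
    (A * spinBlock M : Matrix (FermiIdx Nf L) (FermiIdx Nf L) ℂ) i (quarkEquiv w) =
      ∑ β : Fin 4, A i (quarkEquiv (w.1, (w.2.1, w.2.2.1, β))) * M β w.2.2.2 := by
  obtain ⟨f, x, a, α⟩ := w
  rw [Matrix.mul_apply, ← Equiv.sum_comp quarkEquiv]
  simp only [spinBlock_apply, Fintype.sum_prod_type, mul_ite, mul_zero]
  rw [Finset.sum_eq_single f (fun f' _ hf' => by simp [hf']) (fun h => absurd (Finset.mem_univ f) h),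
    Finset.sum_eq_single x (fun x' _ hx' => by simp [hx']) (fun h => absurd (Finset.mem_univ x) h),
    Finset.sum_eq_single a (fun a' _ ha' => by simp [ha']) (fun h => absurd (Finset.mem_univ a) h)]
  simp

/-- **The rotated antiperiodic action matrix** `M(U) = (1⊗W)(−D^{AP}(U))(1⊗Wᴴ)`: `R' e^{−ψ̄Dψ} = e^{ψ̄Mψ}`.
[cite: MontvayMunster1994, §4.2.3 (4.102)] -/
def rotDirac (U : GaugeConfig 4 L 𝔾) (mq : Fin Nf → ℝ) : Matrix (FermiIdx Nf L) (FermiIdx Nf L) ℂ :=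
  spinBlock spinW * (-diracMatrixAP U mq) * spinBlock spinWᴴ

/-- **The quark Boltzmann factor in the frame**: `R' e^{−ψ̄D^{AP}(U)ψ} = e^{ψ̄M(U)ψ}` (the same element as
`grassmannExp (rotAction mq U)` of `QCDSiteRPBlocks`). [cite: MontvayMunster1994, §4.1 (4.14)–(4.17)] -/
theorem spinUnrot_fermiBoltzmannAP_eq (U : GaugeConfig 4 L 𝔾) (mq : Fin Nf → ℝ) :
    spinUnrot (fermiBoltzmannAP U mq) = grassmannExp (quadratic ℂ (rotDirac U mq)) := by
  rw [fermiBoltzmannAP, spinUnrot_grassmannExp_quadratic, rotDirac]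

/-- **Entries of the rotated action matrix**: flavour diagonal, with the `4 × 4` spin block
`−W (wBlock) Wᴴ = −2(m+4)δ + ½Σ_μ (hopF (2 − Γ_μ) + hopB (2 + Γ_μ))`. [cite: MontvayMunster1994, §4.2.3 (4.102)–(4.104)] -/
theorem rotDirac_apply (U : GaugeConfig 4 L 𝔾) (mq : Fin Nf → ℝ) (v w : QuarkVar Nf L) :
    rotDirac U mq (quarkEquiv v) (quarkEquiv w) =
      if v.1 = w.1 then
        -((spinW * wBlock U (mq v.1) 1 v.2.1 v.2.2.1 w.2.1 w.2.2.1 * spinWᴴ) v.2.2.2 w.2.2.2)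
      else 0 := by
  rw [rotDirac, mul_spinBlock_apply]
  simp only [spinBlock_mul_apply, Matrix.neg_apply, diracMatrixAP_apply]
  by_cases hf : v.1 = w.1
  · simp only [hf, if_true, Matrix.mul_apply, wBlock, Matrix.of_apply, Matrix.conjTranspose_apply, Finset.sum_mul,
      mul_neg, neg_mul, Finset.sum_neg_distrib]
  · simp [hf]

omit [NeZero L] in
/-- The spin block of `M(U)` in normal form. [folklore] -/
theorem spinW_wBlock_conjTranspose (U : GaugeConfig 4 L 𝔾) (m : ℝ) (x : TorusSite 4 L) (a : Fin 3)
    (y : TorusSite 4 L) (b : Fin 3) :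
    spinW * wBlock U m 1 x a y b * spinWᴴ =
      (if x = y ∧ a = b then ((m + 4 : ℝ) : ℂ) else 0) • ((2 : ℂ) • (1 : Matrix (Fin 4) (Fin 4) ℂ)) -
        (1 / 2 : ℂ) • ∑ μ : Fin 4,
          (hopF U μ x a y b • ((2 : ℂ) • (1 : Matrix (Fin 4) (Fin 4) ℂ) - rotGamma μ) +
            hopB U μ x a y b • ((2 : ℂ) • (1 : Matrix (Fin 4) (Fin 4) ℂ) + rotGamma μ)) := by
  rw [wBlock_eq]
  simp only [Matrix.mul_sub, Matrix.sub_mul, Matrix.mul_smul, Matrix.smul_mul, Matrix.mul_one,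
    spinW_mul_conjTranspose, Matrix.mul_sum, Matrix.sum_mul, Matrix.mul_add, Matrix.add_mul]
  congr 1
  · norm_num
  · congr 1
    refine Finset.sum_congr rfl fun μ _ => ?_
    simp only [rotGamma, Complex.ofReal_one, one_smul]


/-! #### Entries of `M(U)` in special positions -/

omit [NeZero L] in
/-- `hopF` vanishes off the forward hop. [folklore] -/
theorem hopF_eq_zero_of_ne (U : GaugeConfig 4 L 𝔾) {μ : Fin 4} {x y : TorusSite 4 L} (h : y ≠ Site.shift x μ)
    (a b : Fin 3) : hopF U μ x a y b = 0 := by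
  rw [hopF, if_neg h]

omit [NeZero L] in
/-- `hopB` vanishes off the backward hop. [folklore] -/
theorem hopB_eq_zero_of_ne (U : GaugeConfig 4 L 𝔾) {μ : Fin 4} {x y : TorusSite 4 L} (h : x ≠ Site.shift y μ)
    (a b : Fin 3) : hopB U μ x a y b = 0 := by
  rw [hopB, if_neg h]

omit [NeZero L] in
/-- `hopF` depends only on the link `(x, μ)`. [folklore] -/
theorem hopF_congr {U U' : GaugeConfig 4 L 𝔾} {μ : Fin 4} {x y : TorusSite 4 L}
    (h : y = Site.shift x μ → U (x, μ) = U' (x, μ)) (a b : Fin 3) : hopF U μ x a y b = hopF U' μ x a y b := by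
  unfold hopF
  split_ifs with hy
  · rw [h hy]
  · rfl

omit [NeZero L] in
/-- `hopB` depends only on the link `(y, μ)`. [folklore] -/
theorem hopB_congr {U U' : GaugeConfig 4 L 𝔾} {μ : Fin 4} {x y : TorusSite 4 L}
    (h : x = Site.shift y μ → U (y, μ) = U' (y, μ)) (a b : Fin 3) : hopB U μ x a y b = hopB U' μ x a y b := by
  unfold hopB
  split_ifs with hy
  · rw [h hy]
  · rfl

/-- **Entries of `M(U)`, scalar form**: for `v = (f,x,a,r)`, `w = (g,y,b,s)`,
`M_{vw} = [f = g] ( −2(m_f+4)[x=y, a=b] δ_{rs} + ½ Σ_μ (hopF_μ (2δ_{rs} − (Γ_μ)_{rs}) + hopB_μ (2δ_{rs} + (Γ_μ)_{rs})) )`.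
[cite: MontvayMunster1994, §4.2.3 (4.102)–(4.104)] -/
theorem rotDirac_apply' (U : GaugeConfig 4 L 𝔾) (mq : Fin Nf → ℝ) (v w : QuarkVar Nf L) :
    rotDirac U mq (quarkEquiv v) (quarkEquiv w) =
      if v.1 = w.1 then
        -((if v.2.1 = w.2.1 ∧ v.2.2.1 = w.2.2.1 then ((mq v.1 + 4 : ℝ) : ℂ) else 0) *
            (2 * (1 : Matrix (Fin 4) (Fin 4) ℂ) v.2.2.2 w.2.2.2)) +
          (1 / 2 : ℂ) * ∑ μ : Fin 4,
            (hopF U μ v.2.1 v.2.2.1 w.2.1 w.2.2.1 * (2 * (1 : Matrix (Fin 4) (Fin 4) ℂ) v.2.2.2 w.2.2.2 - rotGamma μ v.2.2.2 w.2.2.2) +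
              hopB U μ v.2.1 v.2.2.1 w.2.1 w.2.2.1 * (2 * (1 : Matrix (Fin 4) (Fin 4) ℂ) v.2.2.2 w.2.2.2 + rotGamma μ v.2.2.2 w.2.2.2))
      else 0 := by
  rw [rotDirac_apply]
  by_cases hf : v.1 = w.1
  · rw [if_pos hf, if_pos hf, spinW_wBlock_conjTranspose]
    simp only [Matrix.sub_apply, Matrix.smul_apply, Matrix.sum_apply, Matrix.add_apply, smul_eq_mul]
    ring
  · rw [if_neg hf, if_neg hf]

/-- **Spin-diagonal entries**: between spins of equal `γ₀`-sign and off the temporal hops, `M(U)` is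
`δ_{rs}` times `−2` times the spin-blind mass-plus-spatial-Wilson entry
`B = (m_f+4)[x=y,a=b] − ½Σ_{j≠0}(hopF_j + hopB_j)` (Montvay–Münster's `B` of (4.104)). [cite: MontvayMunster1994, §4.2.3 (4.104)] -/
theorem rotDirac_apply_of_spinSign_eq (U : GaugeConfig 4 L 𝔾) (mq : Fin Nf → ℝ) (v w : QuarkVar Nf L)
    (hrs : spinSign v.2.2.2 = spinSign w.2.2.2) (hF : hopF U 0 v.2.1 v.2.2.1 w.2.1 w.2.2.1 = 0)
    (hB : hopB U 0 v.2.1 v.2.2.1 w.2.1 w.2.2.1 = 0) :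
    rotDirac U mq (quarkEquiv v) (quarkEquiv w) =
      if v.1 = w.1 ∧ v.2.2.2 = w.2.2.2 then
        -2 * ((if v.2.1 = w.2.1 ∧ v.2.2.1 = w.2.2.1 then ((mq v.1 + 4 : ℝ) : ℂ) else 0) -
          (1 / 2 : ℂ) * ∑ μ : Fin 4, if μ = 0 then 0 else
            (hopF U μ v.2.1 v.2.2.1 w.2.1 w.2.2.1 + hopB U μ v.2.1 v.2.2.1 w.2.1 w.2.2.1))
      else 0 := by
  rw [rotDirac_apply']
  by_cases hf : v.1 = w.1
  · rw [if_pos hf]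
    have hsum : ∀ μ : Fin 4,
        hopF U μ v.2.1 v.2.2.1 w.2.1 w.2.2.1 * (2 * (1 : Matrix (Fin 4) (Fin 4) ℂ) v.2.2.2 w.2.2.2 - rotGamma μ v.2.2.2 w.2.2.2) +
          hopB U μ v.2.1 v.2.2.1 w.2.1 w.2.2.1 * (2 * (1 : Matrix (Fin 4) (Fin 4) ℂ) v.2.2.2 w.2.2.2 + rotGamma μ v.2.2.2 w.2.2.2) =
        (if μ = 0 then 0 else (hopF U μ v.2.1 v.2.2.1 w.2.1 w.2.2.1 + hopB U μ v.2.1 v.2.2.1 w.2.1 w.2.2.1)) *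
          (2 * (1 : Matrix (Fin 4) (Fin 4) ℂ) v.2.2.2 w.2.2.2) := by
      intro μ
      by_cases hμ : μ = 0
      · subst hμ; rw [hF, hB, if_pos rfl]; ring
      · rw [rotGamma_apply_eq_zero_of_eq hμ hrs, if_neg hμ]; ring
    simp only [hsum, ← Finset.sum_mul]
    by_cases hr : v.2.2.2 = w.2.2.2
    · have hc : v.1 = w.1 ∧ v.2.2.2 = w.2.2.2 := ⟨hf, hr⟩
      rw [if_pos hc, hr, Matrix.one_apply_eq]
      ring
    · have hc : ¬ (v.1 = w.1 ∧ v.2.2.2 = w.2.2.2) := fun h => hr h.2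
      rw [if_neg hc, Matrix.one_apply_ne hr]
      ring
  · have hc : ¬ (v.1 = w.1 ∧ v.2.2.2 = w.2.2.2) := fun h => hf h.1
    rw [if_neg hf, if_neg hc]

/-- **The forward temporal hop**: if only `hopF_0` contributes, `M_{vw} = [f=g] δ_{rs} (1 − ε_r) hopF_0`
(non-zero only for the UPPER `ψ̄`-spins `r ≥ 2`, the `ψ̄P⁻` of (4.102)). [cite: MontvayMunster1994, §4.2.3 (4.102)–(4.103)] -/
theorem rotDirac_apply_forward (U : GaugeConfig 4 L 𝔾) (mq : Fin Nf → ℝ) (v w : QuarkVar Nf L)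
    (hxy : ¬ (v.2.1 = w.2.1 ∧ v.2.2.1 = w.2.2.1)) (hFj : ∀ μ, μ ≠ 0 → hopF U μ v.2.1 v.2.2.1 w.2.1 w.2.2.1 = 0)
    (hBμ : ∀ μ, hopB U μ v.2.1 v.2.2.1 w.2.1 w.2.2.1 = 0) :
    rotDirac U mq (quarkEquiv v) (quarkEquiv w) =
      if v.1 = w.1 ∧ v.2.2.2 = w.2.2.2 then (1 - spinSign v.2.2.2) * hopF U 0 v.2.1 v.2.2.1 w.2.1 w.2.2.1 else 0 := by
  rw [rotDirac_apply', if_neg hxy]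
  by_cases hf : v.1 = w.1
  · rw [if_pos hf, Fin.sum_univ_four, hFj 1 (by decide), hFj 2 (by decide), hFj 3 (by decide), hBμ 0, hBμ 1, hBμ 2, hBμ 3]
    by_cases hr : v.2.2.2 = w.2.2.2
    · have hc : v.1 = w.1 ∧ v.2.2.2 = w.2.2.2 := ⟨hf, hr⟩
      rw [if_pos hc, hr, Matrix.one_apply_eq, rotGamma_zero_apply, if_pos rfl]
      ring
    · have hc : ¬ (v.1 = w.1 ∧ v.2.2.2 = w.2.2.2) := fun h => hr h.2
      rw [if_neg hc, Matrix.one_apply_ne hr, rotGamma_zero_apply, if_neg hr]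
      ring
  · have hc : ¬ (v.1 = w.1 ∧ v.2.2.2 = w.2.2.2) := fun h => hf h.1
    rw [if_neg hf, if_neg hc]

/-- **The backward temporal hop**: if only `hopB_0` contributes, `M_{vw} = [f=g] δ_{rs} (1 + ε_r) hopB_0`
(non-zero only for the UPPER `ψ`-spins `s < 2`, the `P⁺ψ` of (4.102)). [cite: MontvayMunster1994, §4.2.3 (4.102)–(4.103)] -/
theorem rotDirac_apply_backward (U : GaugeConfig 4 L 𝔾) (mq : Fin Nf → ℝ) (v w : QuarkVar Nf L)
    (hxy : ¬ (v.2.1 = w.2.1 ∧ v.2.2.1 = w.2.2.1)) (hFμ : ∀ μ, hopF U μ v.2.1 v.2.2.1 w.2.1 w.2.2.1 = 0)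
    (hBj : ∀ μ, μ ≠ 0 → hopB U μ v.2.1 v.2.2.1 w.2.1 w.2.2.1 = 0) :
    rotDirac U mq (quarkEquiv v) (quarkEquiv w) =
      if v.1 = w.1 ∧ v.2.2.2 = w.2.2.2 then (1 + spinSign v.2.2.2) * hopB U 0 v.2.1 v.2.2.1 w.2.1 w.2.2.1 else 0 := by
  rw [rotDirac_apply', if_neg hxy]
  by_cases hf : v.1 = w.1
  · rw [if_pos hf, Fin.sum_univ_four, hBj 1 (by decide), hBj 2 (by decide), hBj 3 (by decide), hFμ 0, hFμ 1, hFμ 2, hFμ 3]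
    by_cases hr : v.2.2.2 = w.2.2.2
    · have hc : v.1 = w.1 ∧ v.2.2.2 = w.2.2.2 := ⟨hf, hr⟩
      rw [if_pos hc, hr, Matrix.one_apply_eq, rotGamma_zero_apply, if_pos rfl]
      ring
    · have hc : ¬ (v.1 = w.1 ∧ v.2.2.2 = w.2.2.2) := fun h => hr h.2
      rw [if_neg hc, Matrix.one_apply_ne hr, rotGamma_zero_apply, if_neg hr]
      ring
  · have hc : ¬ (v.1 = w.1 ∧ v.2.2.2 = w.2.2.2) := fun h => hf h.1
    rw [if_neg hf, if_neg hc]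

/-- **Vanishing entries**: no mass term and no hop gives `M_{vw} = 0`. [folklore] -/
theorem rotDirac_apply_eq_zero (U : GaugeConfig 4 L 𝔾) (mq : Fin Nf → ℝ) (v w : QuarkVar Nf L)
    (hxy : ¬ (v.2.1 = w.2.1 ∧ v.2.2.1 = w.2.2.1)) (hF : ∀ μ, hopF U μ v.2.1 v.2.2.1 w.2.1 w.2.2.1 = 0)
    (hB : ∀ μ, hopB U μ v.2.1 v.2.2.1 w.2.1 w.2.2.1 = 0) :
    rotDirac U mq (quarkEquiv v) (quarkEquiv w) = 0 := by
  rw [rotDirac_apply', if_neg hxy]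
  simp only [hF, hB, zero_mul, add_zero, Finset.sum_const_zero, mul_zero, neg_zero, ite_self]

/-- **`M(U)_{vw}` depends only on the links of the hops between the two sites.** [folklore] -/
theorem rotDirac_congr {U U' : GaugeConfig 4 L 𝔾} (mq : Fin Nf → ℝ) (v w : QuarkVar Nf L)
    (hF : ∀ μ, w.2.1 = Site.shift v.2.1 μ → U (v.2.1, μ) = U' (v.2.1, μ))
    (hB : ∀ μ, v.2.1 = Site.shift w.2.1 μ → U (w.2.1, μ) = U' (w.2.1, μ)) :
    rotDirac U mq (quarkEquiv v) (quarkEquiv w) = rotDirac U' mq (quarkEquiv v) (quarkEquiv w) := by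
  rw [rotDirac_apply', rotDirac_apply']
  simp only [hopF_congr (hF _), hopB_congr (hB _)]

end RotDirac

/-! ### Reflection symmetry of the rotated action -/

section Symmetry

open GrassmannAlgebra

local notation "𝔾" => Matrix.specialUnitaryGroup (Fin 3) ℂ

variable {Nf L : ℕ} [NeZero L]

/-- `Θ_T (ψ̄(−D(U))ψ) = ψ̄(−D(Θ'U))ψ` (odd torus). [cite: MontvayMunster1994, §4.2.3 (4.95) and (4.106)] -/
theorem torusTheta_quadratic_neg_diracMatrixAP (hL : Odd L) (U : GaugeConfig 4 L 𝔾) (mq : Fin Nf → ℝ) :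
    torusTheta (quadratic ℂ (-diracMatrixAP U mq)) = quadratic ℂ (-diracMatrixAP U.negReflect mq) := by
  rw [torusTheta_quadratic, thetaMatrix_neg, thetaMatrix_diracMatrixAP hL]

/-- **Reflection symmetry of the rotated quark action** (odd torus): `Θ' (ψ̄M(U)ψ) = ψ̄M(Θ'U)ψ`.
[cite: MontvayMunster1994, §4.2.3 (4.95) and (4.106)] -/
theorem fermiThetaRot_quadratic_rotDirac (hL : Odd L) (U : GaugeConfig 4 L 𝔾) (mq : Fin Nf → ℝ) :
    fermiThetaRot (quadratic ℂ (rotDirac U mq)) = quadratic ℂ (rotDirac U.negReflect mq) := by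
  have h : quadratic ℂ (rotDirac U mq) = spinUnrot (quadratic ℂ (-diracMatrixAP U mq)) := by
    rw [spinUnrot_quadratic, rotDirac]
  rw [h, ← spinUnrot_torusTheta, torusTheta_quadratic_neg_diracMatrixAP hL, spinUnrot_quadratic, rotDirac]

/-- The same at the level of matrices: `M(U)^{Θ'} = M(Θ'U)`. [cite: MontvayMunster1994, §4.2.3 (4.95) and (4.106)] -/
theorem thetaMatrixRot_rotDirac (hL : Odd L) (U : GaugeConfig 4 L 𝔾) (mq : Fin Nf → ℝ) :
    thetaMatrixRot (rotDirac U mq) = rotDirac U.negReflect mq := by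
  rw [rotDirac, thetaMatrixRot_rot, thetaMatrix_neg, thetaMatrix_diracMatrixAP hL]
  rfl

/-! ### `Θ'` on quadratic forms, entrywise -/

/-- `Θ' ψ_i = ε_i ψ̄_{θi}` indexed by `FermiIdx`. [cite: MontvayMunster1994, §4.2.3 (4.99)] -/
theorem fermiThetaRot_psi' (i : FermiIdx Nf L) :
    fermiThetaRot (psi ℂ i) = spinSign (idxSpin i) • psiBar ℂ (idxRefl i) := by
  obtain ⟨⟨f, x, a, m⟩, rfl⟩ := quarkEquiv.surjective i
  rw [idxSpin_quarkEquiv, idxRefl_quarkEquiv]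
  exact fermiThetaRot_q f x a m

/-- `Θ' ψ̄_i = ε_i ψ_{θi}` indexed by `FermiIdx`. [cite: MontvayMunster1994, §4.2.3 (4.99)] -/
theorem fermiThetaRot_psiBar' (i : FermiIdx Nf L) :
    fermiThetaRot (psiBar ℂ i) = spinSign (idxSpin i) • psi ℂ (idxRefl i) := by
  obtain ⟨⟨f, x, a, m⟩, rfl⟩ := quarkEquiv.surjective i
  rw [idxSpin_quarkEquiv, idxRefl_quarkEquiv]
  exact fermiThetaRot_qbar f x a m

/-- The `Θ'`-conjugate of a fermion matrix, entrywise: `(A^{Θ'})_{pq} = ε_p ε_q conj A_{θq, θp}`. [cite: MontvayMunster1994, §4.2.3 (4.92)] -/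
def reflMatrix (A : Matrix (FermiIdx Nf L) (FermiIdx Nf L) ℂ) : Matrix (FermiIdx Nf L) (FermiIdx Nf L) ℂ :=
  Matrix.of fun p q => spinSign (idxSpin p) * spinSign (idxSpin q) * star (A (idxRefl q) (idxRefl p))

/-- `idxRefl` as a permutation. [folklore] -/
def idxReflPerm : Equiv.Perm (FermiIdx Nf L) :=
  Function.Involutive.toPerm idxRefl idxRefl_idxRefl

/-- **`Θ' (ψ̄ A ψ) = ψ̄ A^{Θ'} ψ` with the entrywise conjugate** (direct generator computation:
`Θ'(A_{ij} ψ̄_i ψ_j) = conj A_{ij} ε_j ε_i ψ̄_{θj} ψ_{θi}`). [cite: MontvayMunster1994, §4.2.3 (4.92)] -/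
theorem fermiThetaRot_quadratic_eq (A : Matrix (FermiIdx Nf L) (FermiIdx Nf L) ℂ) :
    fermiThetaRot (quadratic ℂ A) = quadratic ℂ (reflMatrix A) := by
  have hterm : ∀ i j : FermiIdx Nf L, fermiThetaRot (A i j • (psiBar ℂ i * psi ℂ j)) =
      reflMatrix A (idxRefl j) (idxRefl i) • (psiBar ℂ (idxRefl j) * psi ℂ (idxRefl i)) := by
    intro i j
    rw [fermiThetaRot.map_smul, fermiThetaRot.map_mul, fermiThetaRot_psi', fermiThetaRot_psiBar',
      smul_mul_smul_comm, smul_smul, reflMatrix, Matrix.of_apply, idxRefl_idxRefl, idxRefl_idxRefl, idxSpin_idxRefl,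
      idxSpin_idxRefl, starRingEnd_apply]
    congr 1
    ring
  rw [quadratic, quadratic, fermiThetaRot.map_sum]
  simp_rw [fermiThetaRot.map_sum, hterm]
  -- reindex `(i, j) ↦ (θj, θi)`
  rw [← Fintype.sum_prod_type', ← Fintype.sum_prod_type']
  let e : FermiIdx Nf L × FermiIdx Nf L ≃ FermiIdx Nf L × FermiIdx Nf L :=
    (Equiv.prodComm _ _).trans (Equiv.prodCongr idxReflPerm idxReflPerm)
  rw [← e.sum_comp]
  refine Fintype.sum_congr _ _ fun x => ?_
  simp [e, idxReflPerm]

/-- `ψ̄_i ψ_j` is the basis monomial of `{ψ̄_i, ψ_j}`. [folklore] -/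
theorem psiBar_mul_psi_eq_grassmannBasis {ι : Type*} [LinearOrder ι] [Fintype ι] (i j : ι) :
    psiBar ℂ i * psi ℂ j = grassmannBasis ℂ (ι ⊕ₗ ι) {toLex (Sum.inl i), toLex (Sum.inr j)} := by
  have hlt : ∀ x ∈ ({toLex (Sum.inr j)} : Finset (ι ⊕ₗ ι)), toLex (Sum.inl i) < x := by
    intro x hx
    rw [Finset.mem_singleton] at hx
    subst hx
    exact Sum.Lex.inl_lt_inr _ _
  have h1 := grassmannBasis_insert_of_forall_lt ℂ hlt
  rw [grassmannBasis_singleton] at h1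
  have h2 : psiBar ℂ i * psi ℂ j = gen ℂ (toLex (Sum.inl i)) * gen ℂ (toLex (Sum.inr j)) := rfl
  rw [h2]
  convert h1.symm using 2 <;> congr

/-- The coefficient of `ψ̄_i ψ_j` in `ψ̄ A ψ` is `A_{ij}`. [folklore] -/
theorem coord_quadratic {ι : Type*} [LinearOrder ι] [Fintype ι] (A : Matrix ι ι ℂ) (i j : ι) :
    (grassmannBasis ℂ (ι ⊕ₗ ι)).coord {toLex (Sum.inl i), toLex (Sum.inr j)} (quadratic ℂ A) = A i j := by
  rw [quadratic, map_sum]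
  simp_rw [map_sum, map_smul, psiBar_mul_psi_eq_grassmannBasis, Module.Basis.coord_apply, Module.Basis.repr_self,
    smul_eq_mul]
  have hkey : ∀ i' j' : ι, (Finsupp.single ({toLex (Sum.inl i'), toLex (Sum.inr j')} : Finset (ι ⊕ₗ ι)) (1 : ℂ))
      {toLex (Sum.inl i), toLex (Sum.inr j)} = if i' = i ∧ j' = j then 1 else 0 := by
    intro i' j'
    rw [Finsupp.single_apply]
    congr 1
    apply propext
    constructor
    · intro h
      have h1 : toLex (Sum.inl i') ∈ ({toLex (Sum.inl i), toLex (Sum.inr j)} : Finset (ι ⊕ₗ ι)) := by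
        rw [← h]; simp
      have h2 : toLex (Sum.inr j') ∈ ({toLex (Sum.inl i), toLex (Sum.inr j)} : Finset (ι ⊕ₗ ι)) := by
        rw [← h]; simp
      simp only [Finset.mem_insert, Finset.mem_singleton, toLex_inj, Sum.inl.injEq, reduceCtorEq, or_false,
        Sum.inr.injEq, false_or] at h1 h2
      exact ⟨h1, h2⟩
    · rintro ⟨rfl, rfl⟩; rfl
  simp_rw [hkey, mul_ite, mul_one, mul_zero]
  rw [Finset.sum_eq_single i (fun i' _ hi' => by simp [hi']) (fun h => absurd (Finset.mem_univ i) h)]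
  simp

/-- **`A ↦ ψ̄ A ψ` is injective.** [folklore] -/
theorem quadratic_injective {ι : Type*} [LinearOrder ι] [Fintype ι] :
    Function.Injective (quadratic ℂ : Matrix ι ι ℂ → GrassmannAlgebra ℂ (ι ⊕ₗ ι)) := by
  intro A B h
  ext i j
  rw [← coord_quadratic A i j, ← coord_quadratic B i j, h]

/-- **Entries of `thetaMatrixRot`**: `(A^{Θ'})_{pq} = ε_p ε_q conj A_{θq,θp}` (spin DIAGONAL in the frame). [folklore] -/
theorem thetaMatrixRot_eq_reflMatrix (A : Matrix (FermiIdx Nf L) (FermiIdx Nf L) ℂ) : thetaMatrixRot A = reflMatrix A :=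
  quadratic_injective (by rw [← fermiThetaRot_quadratic, fermiThetaRot_quadratic_eq])

/-- **`M(Θ'U) = M(U)^{Θ'}` entrywise.** [cite: MontvayMunster1994, §4.2.3 (4.95) and (4.106)] -/
theorem reflMatrix_rotDirac (hL : Odd L) (U : GaugeConfig 4 L 𝔾) (mq : Fin Nf → ℝ) :
    reflMatrix (rotDirac U mq) = rotDirac U.negReflect mq := by
  rw [← thetaMatrixRot_eq_reflMatrix, thetaMatrixRot_rotDirac hL]

end Symmetry

/-! ### Time-block masks and the split of the action -/

section Masks

open GrassmannAlgebra

local notation "𝔾" => Matrix.specialUnitaryGroup (Fin 3) ℂ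

variable {Nf L : ℕ} [NeZero L]

/-- The time-block mask of a fermion matrix: keep the entries whose pair of times satisfies `ρ`. [cite: MontvayMunster1994, §4.2.3 (4.93) and (4.100)] -/
def maskT (ρ : ℕ → ℕ → Prop) [DecidableRel ρ] (A : Matrix (FermiIdx Nf L) (FermiIdx Nf L) ℂ) :
    Matrix (FermiIdx Nf L) (FermiIdx Nf L) ℂ :=
  Matrix.of fun p q => if ρ (idxTime p) (idxTime q) then A p q else 0

/-- Entries of a masked matrix. [folklore] -/
@[simp] theorem maskT_apply (ρ : ℕ → ℕ → Prop) [DecidableRel ρ] (A : Matrix (FermiIdx Nf L) (FermiIdx Nf L) ℂ)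
    (p q : FermiIdx Nf L) : maskT ρ A p q = if ρ (idxTime p) (idxTime q) then A p q else 0 := rfl

/-- The time reflection on time values: `0 ↦ 0`, `t ↦ L − t`. [folklore] -/
def timeRefl (L t : ℕ) : ℕ := if t = 0 then 0 else L - t

/-- `idxTime ∘ idxRefl = timeRefl ∘ idxTime`. [folklore] -/
theorem idxTime_idxRefl' (i : FermiIdx Nf L) : idxTime (idxRefl i) = timeRefl L (idxTime i) := idxTime_idxRefl i

/-- Times are `< L`. [folklore] -/
theorem idxTime_lt (i : FermiIdx Nf L) : idxTime i < L := ZMod.val_lt _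

/-- **Masks under the reflection**: `(maskT ρ A)^{Θ'} = maskT ρ' A^{Θ'}` whenever `ρ'` is the
reflected-and-swapped relation on times `< L`. [folklore] -/
theorem reflMatrix_maskT (ρ ρ' : ℕ → ℕ → Prop) [DecidableRel ρ] [DecidableRel ρ']
    (h : ∀ t t', t < L → t' < L → (ρ' t t' ↔ ρ (timeRefl L t') (timeRefl L t)))
    (A : Matrix (FermiIdx Nf L) (FermiIdx Nf L) ℂ) : reflMatrix (maskT ρ A) = maskT ρ' (reflMatrix A) := by
  ext p q
  simp only [reflMatrix, Matrix.of_apply, maskT_apply, idxTime_idxRefl']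
  have h2 := h _ _ (idxTime_lt p) (idxTime_lt q)
  by_cases h1 : ρ' (idxTime p) (idxTime q)
  · rw [if_pos h1, if_pos (h2.1 h1)]
  · rw [if_neg h1, if_neg (mt h2.2 h1), star_zero, mul_zero]

/-- Masks are additive in the relation for disjoint relations. [folklore] -/
theorem maskT_or (ρ₁ ρ₂ : ℕ → ℕ → Prop) [DecidableRel ρ₁] [DecidableRel ρ₂] (hd : ∀ t t', ¬ (ρ₁ t t' ∧ ρ₂ t t'))
    (A : Matrix (FermiIdx Nf L) (FermiIdx Nf L) ℂ) :
    maskT (fun t t' => ρ₁ t t' ∨ ρ₂ t t') A = maskT ρ₁ A + maskT ρ₂ A := by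
  ext p q
  simp only [maskT_apply, Matrix.add_apply]
  have := hd (idxTime p) (idxTime q)
  by_cases h1 : ρ₁ (idxTime p) (idxTime q) <;> by_cases h2 : ρ₂ (idxTime p) (idxTime q) <;> simp_all

/-- The positive-time pairs: both times in `[0, L/2]`, not both `0`. [cite: MontvayMunster1994, §4.2.3 (4.100)] -/
def posR (L : ℕ) (t t' : ℕ) : Prop := (t ≤ L / 2 ∧ t' ≤ L / 2) ∧ ¬ (t = 0 ∧ t' = 0)

/-- The slice pairs: both times `0`. [cite: MontvayMunster1994, §4.2.3 (4.100)] -/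
def zeroR (t t' : ℕ) : Prop := t = 0 ∧ t' = 0

/-- The negative-time pairs: both times in `{0} ∪ (L/2, L)`, not both `0`. [cite: MontvayMunster1994, §4.2.3 (4.100)] -/
def negR (L : ℕ) (t t' : ℕ) : Prop := (t = 0 ∨ L / 2 < t) ∧ (t' = 0 ∨ L / 2 < t') ∧ ¬ (t = 0 ∧ t' = 0)

/-- The crossing pairs of the antiperiodic layer: one time in `[1, L/2]`, the other in `(L/2, L)`.
[cite: MontvayMunster1994, §4.2.4 (4.112)–(4.115)] -/
def crossR (L : ℕ) (t t' : ℕ) : Prop := (1 ≤ t ∧ t ≤ L / 2 ∧ L / 2 < t') ∨ (L / 2 < t ∧ 1 ≤ t' ∧ t' ≤ L / 2)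

/-- `posR` is decidable. [folklore] -/
instance (L : ℕ) : DecidableRel (posR L) := fun _ _ => by unfold posR; infer_instance
/-- `zeroR` is decidable. [folklore] -/
instance : DecidableRel zeroR := fun _ _ => by unfold zeroR; infer_instance
/-- `negR` is decidable. [folklore] -/
instance (L : ℕ) : DecidableRel (negR L) := fun _ _ => by unfold negR; infer_instance
/-- `crossR` is decidable. [folklore] -/
instance (L : ℕ) : DecidableRel (crossR L) := fun _ _ => by unfold crossR; infer_instance

/-- **The four time classes partition the index pairs.** [folklore] -/
theorem maskT_split (A : Matrix (FermiIdx Nf L) (FermiIdx Nf L) ℂ) :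
    A = maskT (posR L) A + maskT (negR L) A + maskT zeroR A + maskT (crossR L) A := by
  ext p q
  simp only [Matrix.add_apply, maskT_apply]
  by_cases h1 : posR L (idxTime p) (idxTime q)
  · have h2 : ¬ negR L (idxTime p) (idxTime q) := by simp only [posR, negR] at *; omega
    have h3 : ¬ zeroR (idxTime p) (idxTime q) := by simp only [posR, zeroR] at *; omega
    have h4 : ¬ crossR L (idxTime p) (idxTime q) := by simp only [posR, crossR] at *; omega
    simp [h1, h2, h3, h4]
  · by_cases h2 : negR L (idxTime p) (idxTime q)
    · have h3 : ¬ zeroR (idxTime p) (idxTime q) := by simp only [negR, zeroR] at *; omega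
      have h4 : ¬ crossR L (idxTime p) (idxTime q) := by simp only [negR, crossR] at *; omega
      simp [h1, h2, h3, h4]
    · by_cases h3 : zeroR (idxTime p) (idxTime q)
      · have h4 : ¬ crossR L (idxTime p) (idxTime q) := by simp only [zeroR, crossR] at *; omega
        simp [h1, h2, h3, h4]
      · have h4 : crossR L (idxTime p) (idxTime q) := by simp only [posR, negR, zeroR, crossR] at *; omega
        simp [h1, h2, h3, h4]

omit [NeZero L] in
/-- Reflected positive pairs are the negative pairs (`L` odd). [folklore] -/
theorem negR_iff_posR_timeRefl (hL : Odd L) {t t' : ℕ} (ht : t < L) (ht' : t' < L) :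
    negR L t t' ↔ posR L (timeRefl L t') (timeRefl L t) := by
  obtain ⟨k, hk⟩ := hL
  simp only [negR, posR, timeRefl]
  split_ifs <;> omega

omit [NeZero L] in
/-- Reflected negative pairs are the positive pairs (`L` odd). [folklore] -/
theorem posR_iff_negR_timeRefl (hL : Odd L) {t t' : ℕ} (ht : t < L) (ht' : t' < L) :
    posR L t t' ↔ negR L (timeRefl L t') (timeRefl L t) := by
  obtain ⟨k, hk⟩ := hL
  simp only [negR, posR, timeRefl]
  split_ifs <;> omega

omit [NeZero L] in
/-- The slice pairs are reflection invariant. [folklore] -/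
theorem zeroR_iff_zeroR_timeRefl {t t' : ℕ} (ht : t < L) (ht' : t' < L) :
    zeroR t t' ↔ zeroR (timeRefl L t') (timeRefl L t) := by
  simp only [zeroR, timeRefl]
  split_ifs <;> omega

omit [NeZero L] in
/-- The crossing pairs are reflection invariant (`L` odd). [folklore] -/
theorem crossR_iff_crossR_timeRefl (hL : Odd L) {t t' : ℕ} (ht : t < L) (ht' : t' < L) :
    crossR L t t' ↔ crossR L (timeRefl L t') (timeRefl L t) := by
  obtain ⟨k, hk⟩ := hL
  simp only [crossR, timeRefl]
  split_ifs <;> omega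

/-- The positive-time part of the rotated action, `Q₊(U) = ψ̄ M₊(U) ψ`. [cite: MontvayMunster1994, §4.2.3 (4.100)] -/
def posPart (U : GaugeConfig 4 L 𝔾) (mq : Fin Nf → ℝ) : FermiAlg Nf L := quadratic ℂ (maskT (posR L) (rotDirac U mq))

/-- The negative-time part `Q₋(U)`. [cite: MontvayMunster1994, §4.2.3 (4.100)] -/
def negPart (U : GaugeConfig 4 L 𝔾) (mq : Fin Nf → ℝ) : FermiAlg Nf L := quadratic ℂ (maskT (negR L) (rotDirac U mq))

/-- The slice part `Q₀(U)` (Montvay–Münster's `−S^{(0)}`). [cite: MontvayMunster1994, §4.2.3 (4.100) and (4.104)] -/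
def zeroPart (U : GaugeConfig 4 L 𝔾) (mq : Fin Nf → ℝ) : FermiAlg Nf L := quadratic ℂ (maskT zeroR (rotDirac U mq))

/-- The crossing part `Q_c(U)` (the hops through the antiperiodic layer). [cite: MontvayMunster1994, §4.2.4 (4.112)–(4.115)] -/
def crossPart (U : GaugeConfig 4 L 𝔾) (mq : Fin Nf → ℝ) : FermiAlg Nf L := quadratic ℂ (maskT (crossR L) (rotDirac U mq))

/-- **The split of the rotated action**: `ψ̄M(U)ψ = Q₊ + Q₋ + Q₀ + Q_c`. [cite: MontvayMunster1994, §4.2.3 (4.100)] -/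
theorem quadratic_rotDirac_split (U : GaugeConfig 4 L 𝔾) (mq : Fin Nf → ℝ) :
    quadratic ℂ (rotDirac U mq) = posPart U mq + negPart U mq + zeroPart U mq + crossPart U mq := by
  rw [posPart, negPart, zeroPart, crossPart, ← quadratic_add, ← quadratic_add, ← quadratic_add, ← maskT_split]

/-- **`Θ' Q₊(U) = Q₋(Θ'U)`** (`L` odd). [cite: MontvayMunster1994, §4.2.3 (4.106)] -/
theorem fermiThetaRot_posPart (hL : Odd L) (U : GaugeConfig 4 L 𝔾) (mq : Fin Nf → ℝ) :
    fermiThetaRot (posPart U mq) = negPart U.negReflect mq := by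
  rw [posPart, negPart, fermiThetaRot_quadratic_eq, reflMatrix_maskT (posR L) (negR L)
    (fun t t' ht ht' => negR_iff_posR_timeRefl hL ht ht'), reflMatrix_rotDirac hL]

/-- `Θ' Q₋(U) = Q₊(Θ'U)` (`L` odd). [cite: MontvayMunster1994, §4.2.3 (4.106)] -/
theorem fermiThetaRot_negPart (hL : Odd L) (U : GaugeConfig 4 L 𝔾) (mq : Fin Nf → ℝ) :
    fermiThetaRot (negPart U mq) = posPart U.negReflect mq := by
  rw [posPart, negPart, fermiThetaRot_quadratic_eq, reflMatrix_maskT (negR L) (posR L)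
    (fun t t' ht ht' => posR_iff_negR_timeRefl hL ht ht'), reflMatrix_rotDirac hL]

/-- `Θ' Q₀(U) = Q₀(Θ'U)`. [cite: MontvayMunster1994, §4.2.3 (4.106)] -/
theorem fermiThetaRot_zeroPart (hL : Odd L) (U : GaugeConfig 4 L 𝔾) (mq : Fin Nf → ℝ) :
    fermiThetaRot (zeroPart U mq) = zeroPart U.negReflect mq := by
  rw [zeroPart, zeroPart, fermiThetaRot_quadratic_eq, reflMatrix_maskT zeroR zeroR
    (fun t t' ht ht' => zeroR_iff_zeroR_timeRefl ht ht'), reflMatrix_rotDirac hL]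

/-- `Θ' Q_c(U) = Q_c(Θ'U)` (`L` odd). [cite: MontvayMunster1994, §4.2.3 (4.106)] -/
theorem fermiThetaRot_crossPart (hL : Odd L) (U : GaugeConfig 4 L 𝔾) (mq : Fin Nf → ℝ) :
    fermiThetaRot (crossPart U mq) = crossPart U.negReflect mq := by
  rw [crossPart, crossPart, fermiThetaRot_quadratic_eq, reflMatrix_maskT (crossR L) (crossR L)
    (fun t t' ht ht' => crossR_iff_crossR_timeRefl hL ht ht'), reflMatrix_rotDirac hL]

end Masks

end Literature.MathematicalPhysics.QuantumFieldTheory
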